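import Summits.Ventures.CertifiedManyBodySolver.Theses.TcThermcert1
import Summits.Ventures.CertifiedManyBodySolver.Theorems.TcThermcert1FarCutCurrentOfClustering
import Summits.Ventures.CertifiedManyBodySolver.Theorems.TcThermcert1GcHighTemperature
import Summits.Ventures.CertifiedManyBodySolver.Theorems.TcThermcert1FugacityProjection
import Summits.Ventures.CertifiedManyBodySolver.Theorems.ThermalStiffnessCeilingU8b8_le_7o44.Negative.CurrentCovarianceLocality
import Literature.MathematicalPhysics.QuantumLattice.HubbardHighTemperatureDecay
import Literature.MathematicalPhysics.QuantumLattice.HubbardNNNHoppingFluxThermal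
import Literature.MathematicalPhysics.QuantumLattice.FermionLiebRobinson
import Literature.MathematicalPhysics.QuantumLattice.LatticeTori
import HarnessLib

/-!
# Crux idea `kms-analyticity-bridge` — SKETCH (elaborates; NOT a registered line, NOT a stub edition)

Crux K1′ = `TcThermcert1.ThermalStiffnessCeilingU8b8_le_7o44` (stmt-Ventures-24560); the line
`Lines/gauge_qbp_far_seam.lean` v1.4 (840eb8f8df757ab5) has reduced it, kernel-checked, to THE BET

  `C8 : ∃ ξ, CurrentClustering 8 (7/8) 8 ξ`   (registered stub `stub_currentClustering8`).

Director ruling (hubbard g19, «RULING ON THE BET C8», tc INBOX I2348; WAKE plan-1 2026-08-29T21:16Z):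
file the honest typable shape «C8 ⇐ uniqueness ∕ analyticity (no phase transition) of the sector KMS state at
(U, n) = (8, 7/8) for all T ≥ t/8», hypothesis TYPED over tree declarations; and type the SMALL-β `U = 8` rung.

This file does exactly that and nothing more:

* §0  the line's objects, copied VERBATIM from `Lines/gauge_qbp_far_seam.lean` v1.4 §0–§1 (the `Cruxes/…` modules
      have no farm build and cannot be imported; `currentClustering_beta_zero` below certifies by `rfl`-unfolding
      that the copies are the tree's objects: it is F4 `currentClusteringBody_beta_zero` re-typed through them);
* §1  the two-fugacity grand-canonical objects (the objects of K2 =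
      `ZeroFreeCorridor.gcHighTempAnalytic`, `TcThermcert1GcHighTemperature.lean` l.87–95, at `tp = θ = 0`, real `β`);
* §2  `RegularPhasePoint U n β` — the typed hypothesis: «(β, n) is a regular point of the unique analytic
      (high-temperature) phase of the flux-free `t–U` torus gas», in L-uniform finite-volume GRAND-CANONICAL currency
      (canonical all-pairs clustering is REFUTED at β = 0 by F6 `CanonicalDensityPlateau`, so the hypothesis must
      live grand-canonically and reach the sector through the fugacity-torus projection
      `ZeroFreeCorridor.hubbardTorusTT'Flux_sector_trace_exp_eq_torusIntegral`), and `NoTransitionDownTo U n β₁`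
      — its path version «for all T ≥ t/β₁»;
* §3  the bridge `RegularPhasePoint U n β → ∃ ξ, CurrentClustering U n β ξ` as a SORRIED stub, its composition to C8
      (kernel-checked, no sorry of its own), the small-β rung in the WAKE's exact shape as a SORRIED stub together
      with its intended two-piece decomposition (kernel-checked composition).

Sorries: exactly the three `stub_*` declarations. Nothing here proves C8, K1′, K1, the leaf or any summit statement.
-/

noncomputable section

namespace Summit.Ventures.CertifiedManyBodySolver.Cruxes.ThermalStiffnessCeilingU8b8_le_7o44.Ideas.KmsAnalyticityBridge

open Filter Topology Set Matrix
open Literature.MathematicalPhysics.QuantumLattice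
open Literature.Probability.LatticeModels
open Summit.Ventures.CertifiedManyBodySolver.Observables
open Summit.Ventures.CertifiedManyBodySolver.Theorems.TcThermcert1.GaugeQbpFarSeam
open scoped Matrix.Norms.L2Operator ComplexOrder ComplexConjugate

/-! ## §0 The line's objects (VERBATIM from `Lines/gauge_qbp_far_seam.lean` v1.4 §0–§1) -/

section Objects

variable (L : ℕ) [NeZero L]

/-- Fock-space operators of the `L × L` torus (verbatim copy). -/
abbrev FockOp : Type := Matrix (Finset (Orb (FermionTorus 2 L))) (Finset (Orb (FermionTorus 2 L))) ℂ

/-- The `(N_L, S^z = 0)` sector predicate at doping `δ`, `N_L = 2⌊(1-δ)L²/2⌋` (verbatim copy). -/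
abbrev sectorPred (δ : ℝ) : Finset (Orb (FermionTorus 2 L)) → Prop :=
  fun s => s.card = 2 * ⌊(1 - δ) * (L : ℝ) ^ 2 / 2⌋₊ ∧
    2 * (s.filter fun i => (ofLex i).2 = 0).card = 2 * ⌊(1 - δ) * (L : ℝ) ^ 2 / 2⌋₊

/-- Sector-preserving operators (verbatim copy). -/
def SectorPreserving (δ : ℝ) (A : FockOp L) : Prop :=
  ∀ s t, sectorPred L δ s → ¬ sectorPred L δ t → A s t = 0 ∧ A t s = 0

/-- The canonical sector Gibbs expectation (verbatim copy). -/
def sectorExpect (δ β : ℝ) (H A : FockOp L) : ℂ :=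
  gibbsState β (H.toBlock (sectorPred L δ) (sectorPred L δ)) (A.toBlock (sectorPred L δ) (sectorPred L δ))

/-- The plain bond current across the bond `(X-1, y)–(X, y)` (verbatim copy). -/
def bondCurrent (X y : ZMod L) : FockOp L :=
  ∑ σ : Fin 2,
    ((-Complex.I) • (creation (orb (FermionTorus.ofTorusSite ![X, y]) σ) *
        annihilation (orb (FermionTorus.ofTorusSite ![X - 1, y]) σ)) +
      Complex.I • (creation (orb (FermionTorus.ofTorusSite ![X - 1, y]) σ) *
        annihilation (orb (FermionTorus.ofTorusSite ![X, y]) σ)))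

end Objects

/-- **Hypothesis C of the line** (verbatim copy of `CurrentClustering`, `Lines/gauge_qbp_far_seam.lean` v1.4 l.152–162):
uniform exponential clustering of the flux-free canonical sector Gibbs state against the bond currents. -/
def CurrentClustering (U n β ξ : ℝ) : Prop :=
  0 < ξ ∧ ∃ C : ℝ, ∃ k L₀ : ℕ, ∀ (L : ℕ) [NeZero L], L₀ ≤ L →
    ∀ (X : Finset (FermionTorus 2 L)) (A : FockOp L),
      A ∈ carEvenSubalgebra (orbSet X) → SectorPreserving L (1 - n) A →
      ∀ (X₀ y : ZMod L) (d : ℕ),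
        (∀ x ∈ X, d ≤ torusDist x.toTorusSite ![X₀, y] ∧
          d ≤ torusDist x.toTorusSite ![X₀ - 1, y]) →
        ‖sectorExpect L (1 - n) β (hubbardTorusTT'Flux L 0 U 0) (A * bondCurrent L X₀ y)
            - sectorExpect L (1 - n) β (hubbardTorusTT'Flux L 0 U 0) A
              * sectorExpect L (1 - n) β (hubbardTorusTT'Flux L 0 U 0) (bondCurrent L X₀ y)‖
          ≤ C * ‖A‖ * (X.card : ℝ) ^ k * Real.exp (-(d : ℝ) / ξ)

/-- **Consistency ∕ object check (PROVED, = F4).** At `β = 0` Hypothesis C holds for every `U, n` (Disproof ed. 3 §5,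
landed F4 `CurrentCovarianceLocality.currentClusteringBody_beta_zero`): the verbatim copies above unfold to the tree's body. -/
theorem currentClustering_beta_zero (U n : ℝ) : CurrentClustering U n 0 1 :=
  Summit.Ventures.CertifiedManyBodySolver.Theorems.TcThermcert1.CurrentCovarianceLocality.currentClusteringBody_beta_zero
    U n one_pos

/-! ## §1 Two-fugacity grand-canonical objects (the objects of K2 `ZeroFreeCorridor.gcHighTempAnalytic`) -/

section GrandCanonical

variable (L : ℕ) [NeZero L]

/-- Half the sector particle number, `M_L(δ) = ⌊(1-δ)L²/2⌋`: `sectorPred L δ` is the `(M_L, M_L)` spin sector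
(`ZeroFreeCorridor.card_and_two_mul_card_filter_iff`). -/
abbrev sectorHalfN (δ : ℝ) : ℕ := ⌊(1 - δ) * (L : ℝ) ^ 2 / 2⌋₊

/-- The point `ζ = (r e^{iφ}, r e^{iψ})` of the fugacity torus `|ζ↑| = |ζ↓| = r`
(parametrisation of `ZeroFreeCorridor.hubbardTorusTT'Flux_sector_trace_exp_eq_torusIntegral`). -/
def fugacityPt (r φ ψ : ℝ) : ℂ × ℂ :=
  ((r : ℂ) * Complex.exp ((φ : ℂ) * Complex.I), (r : ℂ) * Complex.exp ((ψ : ℂ) * Complex.I))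

/-- The two-fugacity tilt `diag(ζ↑^{N↑(s)} ζ↓^{N↓(s)})` (K2's diagonal, `gcHighTempAnalytic` l.93). -/
def fugacityTilt (ζ : ℂ × ℂ) : FockOp L :=
  Matrix.diagonal fun s : Finset (Orb (FermionTorus 2 L)) => ζ.1 ^ (upPart s).card * ζ.2 ^ (downPart s).card

/-- **Tilted insertion trace** `Ξ_L(β; ζ)·⟨Y⟩_ζ := tr(ζ↑^{N↑} ζ↓^{N↓} e^{−βH} Y)` of the flux-free `t–U` torus
`H = hubbardTorusTT'Flux L 0 U 0`; `Y = 1` gives the two-fugacity grand partition function `Ξ_L(β; ζ)` itself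
(K2's left-hand side at `tp = θ = 0`). Entire in `ζ`; no division, no junk value. -/
def gcInsertion (U β : ℝ) (ζ : ℂ × ℂ) (Y : FockOp L) : ℂ :=
  (fugacityTilt L ζ * NormedSpace.exp (-(β : ℂ) • hubbardTorusTT'Flux L 0 U 0) * Y).trace

/-- The sector partition function `Z_{L,δ}(β) = tr e^{−βH_p}`, `p = sectorPred L δ` — the normalisation inside
`sectorExpect` (`gibbsState_apply`). Real and positive for Hermitian `H` (`partitionFn_pos`). -/
def sectorZ (δ β : ℝ) (H : FockOp L) : ℂ :=
  partitionFn β (H.toBlock (sectorPred L δ) (sectorPred L δ))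

end GrandCanonical

/-! ## §2 The typed hypothesis -/

/-- **`RegularPhasePoint U n β` — «(β, n) is a regular point of the unique analytic phase of the `t–U` torus gas»,
the L-uniform finite-volume GRAND-CANONICAL meaning of «the KMS state at inverse temperature β and density n is unique
and analytic: no phase transition at (β, n)», typed in the currency a proof of C8 can consume.**

There are constants — a fugacity window `0 < r₁ ≤ r₂`, a near-arc radius `ρ₀ > 0`, a Gaussian constant `c > 0`,
a correlation length `ξ > 0`, `K, C ≥ 0`-type constants and `k, L₀ : ℕ` — such that for every `L ≥ L₀` some
spin-balanced fugacity `r = r_L ∈ [r₁, r₂]` (the finite-volume saddle of the density-`n` sector) satisfies: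

* **(S) non-degenerate charge saddle** (analytic, strictly stable thermodynamics at density `n`: ONE Gaussian peak of
  `(N↑, N↓)`, positive-definite compressibility, no density coexistence, no criticality — the uniqueness-of-phase
  content in the density variables; sharp two-species local-CLT exponent `L²`):
  `Ξ_L(β; r, r) ≤ K · L² · r^{2M_L} · Z_{L,1-n}(β)`, i.e. `Prob_{r}(N↑ = N↓ = M_L) ≥ (K L²)⁻¹`;
* **(G) Gaussian domination of every tilted current insertion on the whole fugacity torus** (large deviations of the
  charge away from the saddle, with one local time-reversal-odd insertion `A·j`; the volume `L² − |X|` and not `L²`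
  because an observable supported on `X` can absorb the tilt on `X`, e.g. `A = e^{−iφ₀ N↑_X}`):
  `‖tr(ζ^N e^{−βH} A j_{X₀y})‖ ≤ C ‖A‖ |X|^k Ξ_L(β; r, r) e^{−c (L² − |X|)(φ² + ψ²)}` for `ζ = (re^{iφ}, re^{iψ})`,
  `|φ|, |ψ| ≤ π`;
* **(N) near-arc exponential clustering against the current, stable under complex fugacity tilts** (complete-analyticity
  ∕ exponential clustering of the unique phase in the current channel; at `φ = ψ = 0` it is plain grand-canonical
  clustering `|⟨A j⟩_{β,r}| ≤ C‖A‖|X|^k e^{−d/ξ}`, `⟨j⟩_{β,r} = 0`): for `|φ|, |ψ| ≤ ρ₀` the bound of (G) improves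
  by the factor `e^{−d/ξ}`, `d` = the torus distance from `X` to both ends of the bond (the SAME observable class and
  the SAME two-site distance premise as Hypothesis C — the premise is load-bearing, F5).

Consistency: at `β = 0` (G) and (N) hold (product state: the insertion trace factorises and vanishes for `d ≥ 1` by
locality, F4's mechanism; `|1 + re^{iφ}| ≤ (1+r)e^{−c φ²}`) and (S) is the binomial local CLT; the no-insertion,
small-complex-`β` analytic structure of `Ξ_L` is the PROVED K2 theorem `ZeroFreeCorridor.gcHighTempAnalytic`.
Not refuted by F6 (grand-canonical: no Lebowitz–Percus–Verlet plateau) and not Hypothesis C renamed (other ensemble —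
F6 certifies the two ensembles differ at order `1/|Λ|` for generic partners; complex tilts; the clause (S)). -/
def RegularPhasePoint (U n β : ℝ) : Prop :=
  ∃ r₁ r₂ ρ₀ c ξ K C : ℝ, ∃ k L₀ : ℕ, 0 < r₁ ∧ r₁ ≤ r₂ ∧ 0 < ρ₀ ∧ 0 < c ∧ 0 < ξ ∧
    ∀ (L : ℕ) [NeZero L], L₀ ≤ L → ∃ r : ℝ, r₁ ≤ r ∧ r ≤ r₂ ∧
      -- (S) non-degenerate charge saddle: local-CLT lower bound for the `(M_L, M_L)` sector at fugacity `(r, r)`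
      ‖gcInsertion L U β ((r : ℂ), (r : ℂ)) 1‖
          ≤ K * (L : ℝ) ^ 2 * r ^ (2 * sectorHalfN L (1 - n)) * ‖sectorZ L (1 - n) β (hubbardTorusTT'Flux L 0 U 0)‖ ∧
      -- (G) ∧ (N): tilted current insertions on the fugacity torus
      ∀ (φ ψ : ℝ), |φ| ≤ Real.pi → |ψ| ≤ Real.pi →
        ∀ (X : Finset (FermionTorus 2 L)) (A : FockOp L),
          A ∈ carEvenSubalgebra (orbSet X) → SectorPreserving L (1 - n) A →
          ∀ (X₀ y : ZMod L) (d : ℕ),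
            (∀ x ∈ X, d ≤ torusDist x.toTorusSite ![X₀, y] ∧
              d ≤ torusDist x.toTorusSite ![X₀ - 1, y]) →
            -- (G) Gaussian domination, everywhere on the torus
            ‖gcInsertion L U β (fugacityPt r φ ψ) (A * bondCurrent L X₀ y)‖
                ≤ C * ‖A‖ * (X.card : ℝ) ^ k * ‖gcInsertion L U β ((r : ℂ), (r : ℂ)) 1‖ *
                    Real.exp (-(c * ((L : ℝ) ^ 2 - X.card) * (φ ^ 2 + ψ ^ 2))) ∧
            -- (N) near the real point: the extra clustering factor `e^{−d/ξ}`
            (|φ| ≤ ρ₀ → |ψ| ≤ ρ₀ →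
              ‖gcInsertion L U β (fugacityPt r φ ψ) (A * bondCurrent L X₀ y)‖
                ≤ C * ‖A‖ * (X.card : ℝ) ^ k * ‖gcInsertion L U β ((r : ℂ), (r : ℂ)) 1‖ *
                    Real.exp (-(c * ((L : ℝ) ^ 2 - X.card) * (φ ^ 2 + ψ ^ 2))) * Real.exp (-(d : ℝ) / ξ))

/-- **`NoTransitionDownTo U n β₁` — «no phase transition at density `n` for all temperatures `T ≥ t/β₁`»**: every
`(β, n)` with `0 ≤ β ≤ β₁` is a regular point of the unique analytic phase. The director's hypothesis is
`NoTransitionDownTo 8 (7/8) 8`; C8 consumes only its `β = 8` slice (`regularPhasePoint_of_noTransitionDownTo`). -/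
def NoTransitionDownTo (U n β₁ : ℝ) : Prop :=
  ∀ β : ℝ, 0 ≤ β → β ≤ β₁ → RegularPhasePoint U n β

/-- The `β = β₁` slice of the path hypothesis (PROVED, trivial). -/
theorem regularPhasePoint_of_noTransitionDownTo {U n β₁ : ℝ} (hβ₁ : 0 ≤ β₁) (h : NoTransitionDownTo U n β₁) :
    RegularPhasePoint U n β₁ :=
  h β₁ hβ₁ le_rfl

/-! ## §3 The bridge and the small-β rung (SORRIED stubs; compositions kernel-checked) -/

/-- **STUB (the bridge; the card's first lemma) — a regular phase point clusters canonically against the current.**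
`RegularPhasePoint U n β → ∃ ξ', CurrentClustering U n β ξ'` for every `U, n, β`.  Intended proof (size L; every
ingredient finite-dimensional and in the tree's currency): (1) Fourier extraction WITH insertion — for sector-preserving
`A`, `Z_p·ω_p(A j) = (2π)⁻² ∬ tr(ζ^N e^{−βH} A j) ζ↑^{−M} ζ↓^{−M} dφ dψ` on `|ζσ| = r` and `Z_p = (2π)⁻² ∬ Ξ_L(ζ) ζ^{−(M,M)}`
(`ZeroFreeCorridor.trace_exp_neg_smul_toBlock_eq_sum_ite` ∕ `…_eq_torusIntegral`, `toBlock_exp_of_toBlock_compl_eq_zero`);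
(2) `ω_p(j) = 0` (F1 `CurrentCovarianceTRBlind.gibbsState_fluxZeroBlock_farBond_eq_zero`), so the covariance IS `ω_p(A j)`
— this is where the time-reversal-oddness of the current enters and why no Lebowitz–Percus–Verlet plateau (F6) appears;
(3) modulus bound of the contour integral by (G) on the far arc and (N) on the near arc, normalised by (S):
`|ω_p(A j)| ≤ C K L² ‖A‖ |X|^k [e^{−d/ξ}·(4c(L²−|X|))⁻¹ + e^{−c(L²−|X|)ρ₀²}]`; (4) torus geometry: `X` avoids the two
`d`-balls at the bond ends, so `L² − |X| ≥ min(2d+1, L)²`, whence `e^{−c(L²−|X|)ρ₀²} ≤ e^{1/(16cρ₀²ξ²)} e^{−d/ξ}` and the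
factor `L²/(L² − |X|)` is `≤ 2` when `|X| ≤ L²/2` and `≤ 2|X|` otherwise — absorbed into `|X|^{k+1}`. Output constants
`(ξ' = ξ, C' = C K (…), k + 1, L₀)`, all `L`-uniform. Why it might fail: only through a slip in this bookkeeping — the
statement was DESIGNED so that (S)(G)(N) are exactly what (1)–(4) consume; the mathematical risk sits in the hypothesis. -/
theorem stub_currentClustering_of_regularPhasePoint (U n β : ℝ) :
    RegularPhasePoint U n β → ∃ ξ : ℝ, CurrentClustering U n β ξ := by
  sorry

/-- **THE BET C8 from the director's hypothesis (composition kernel-checked; the only sorry is the bridge stub).**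
`NoTransitionDownTo 8 (7/8) 8 → C8`: «C8 ⇐ uniqueness ∕ analyticity (no phase transition) of the KMS state at
(U, n) = (8, 7/8) for all T ≥ t/8». TRANSFER ∕ WHY-EASIER: it is not easier; it is the named physical content. -/
theorem currentClustering8_of_noTransition (h : NoTransitionDownTo 8 (7 / 8) 8) :
    ∃ ξ : ℝ, CurrentClustering 8 (7 / 8) 8 ξ :=
  stub_currentClustering_of_regularPhasePoint 8 (7 / 8) 8 (regularPhasePoint_of_noTransitionDownTo (by norm_num) h)

/-- The same from the single slice `RegularPhasePoint 8 (7/8) 8` (what C8 actually consumes). -/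
theorem currentClustering8_of_regularPhasePoint (h : RegularPhasePoint 8 (7 / 8) 8) :
    ∃ ξ : ℝ, CurrentClustering 8 (7 / 8) 8 ξ :=
  stub_currentClustering_of_regularPhasePoint 8 (7 / 8) 8 h

/-- **STUB (small-β regularity at `U = 8`, `n = 7/8`) — the cluster-expansion half of the rung.** For `0 ≤ β ≤ β₀`
(some `β₀ > 0`, expected `β₀ ~ ZeroFreeCorridor.gcHighTempAnalytic`'s `η₀ ≲ 10⁻⁶/t`, cf. `SourceGas.betaHT = (4·35²·e⁶)⁻¹`)
the point `(β, 7/8)` is regular: (S) from the two-species local CLT of the weakly-coupled polymer gas around fugacity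
`r = 7/9 ∈ (2/3, 8/9)` (K2's annulus); (G) and (N) from the two-fugacity cluster expansion WITH TWO LOCAL INSERTIONS
(`A` and `j`; engine: Ueltschi's source-gas expansion `SourceGas.norm_hubbardThermalTwoPoint_le_exp_neg`
[Ueltschi1999 Thm 2.1(iii)] and K2's parts `TcThermcert1Gc*` 0–11), the vanishing of the disconnected term using the
current's oddness (`trace_exp_mul_bondOp_eq_zero`, Koma–Tasaki). Inside S's trivially-known high-temperature regime. -/
theorem stub_regularPhasePoint8_smallBeta :
    ∃ β₀ : ℝ, 0 < β₀ ∧ ∀ β : ℝ, 0 ≤ β → β ≤ β₀ → RegularPhasePoint 8 (7 / 8) β := by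
  sorry

/-- **STUB — THE SMALL-β `U = 8` RUNG in the WAKE's exact shape** («∃ β₀ > 0, ∀ 0 < β ≤ β₀, ∃ ξ, CurrentClustering 8 (7/8) β ξ»):
the NEXT SUMMON OBJECT for the `hub-tc-therm-sw-*` lineage after [B-4]. CLASSIFICATION (director): it sits inside S's
trivially-known high-temperature regime, so it is a HELPER RUNG for the C-family at strong coupling, NOT a BC5 witness.
It is NOT registered here (no `ledger skeleton check`; a registering edition is a crux event = director's call). Its
intended proof is the kernel-checked composition `currentClustering8_smallBeta_of` below: bridge + small-β regularity —
NOT «grand-canonical two-point decay + additive ensemble equivalence», which F6 refutes as a template. -/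
theorem stub_currentClustering8_smallBeta :
    ∃ β₀ : ℝ, 0 < β₀ ∧ ∀ β : ℝ, 0 < β → β ≤ β₀ → ∃ ξ : ℝ, CurrentClustering 8 (7 / 8) β ξ := by
  sorry

/-- **Decomposition of the rung (PROVED composition):** bridge (every `β`) + small-β regularity ⇒ the rung. -/
theorem currentClustering8_smallBeta_of
    (hbridge : ∀ β : ℝ, RegularPhasePoint 8 (7 / 8) β → ∃ ξ : ℝ, CurrentClustering 8 (7 / 8) β ξ)
    (hreg : ∃ β₀ : ℝ, 0 < β₀ ∧ ∀ β : ℝ, 0 ≤ β → β ≤ β₀ → RegularPhasePoint 8 (7 / 8) β) :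
    ∃ β₀ : ℝ, 0 < β₀ ∧ ∀ β : ℝ, 0 < β → β ≤ β₀ → ∃ ξ : ℝ, CurrentClustering 8 (7 / 8) β ξ := by
  obtain ⟨β₀, hβ₀, h⟩ := hreg
  exact ⟨β₀, hβ₀, fun β hβ hβle => hbridge β (h β hβ.le hβle)⟩

/-- The rung from the two finer stubs (kernel-checked; sorries only inside the two stubs it names). -/
theorem currentClustering8_smallBeta' :
    ∃ β₀ : ℝ, 0 < β₀ ∧ ∀ β : ℝ, 0 < β → β ≤ β₀ → ∃ ξ : ℝ, CurrentClustering 8 (7 / 8) β ξ :=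
  currentClustering8_smallBeta_of (fun β => stub_currentClustering_of_regularPhasePoint 8 (7 / 8) β)
    stub_regularPhasePoint8_smallBeta

end Summit.Ventures.CertifiedManyBodySolver.Cruxes.ThermalStiffnessCeilingU8b8_le_7o44.Ideas.KmsAnalyticityBridge

end
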